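import Summits.AtomisticToContinuum.HydrodynamicLimit.Theorems.BoltzmannGreenKubo.Negative.AllWindows

/-!
# The truncated shear stress and its remainder (helper file 3/5 for
# `OneFlightGossipEngine.EquilibriumStressVarianceDecay`, stmt-AtomisticToContinuum-9531)

To feed the shear-stress germ `ĝ(w) = w₀w₁` (unbounded) into `FastObservableMeanErgodic` (which asks for
a BOUNDED continuous `g ⊥ span(1, v, |v|²)` in `L²(γ)`, `γ` the standard Gaussian on `ℝ³`) we truncate.
No new definitions are introduced: every lemma is about functions `t, r : ℝ³ → ℝ` satisfying the
defining identities

* `ht : ∀ w, t w = w₀ w₁ (1 + |w|²/A)⁻¹` — the TRUNCATION at level `A > 0`: bounded by `A/2`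
  (`abs_trunc_le`), continuous, odd under the coordinate reflections `w₀ ↦ −w₀`, `w₁ ↦ −w₁`
  (`trunc_reflB_zero`, `trunc_reflB_one`), hence centred and `γ`-orthogonal to `span(1, v, |v|²)` in
  the exact form of the milestone's hypothesis (`trunc_orth`); `∫ t² dγ ≤ E_γ|w|⁴` uniformly in `A`;
* `hr : ∀ w, r w = w₀ w₁ − t w` — the REMAINDER `= w₀w₁|w|²/(A + |w|²)` (`rem_eq`): odd, centred,
  `|r| ≤ |w|⁴/(2A)` (`abs_rem_le`), in `L²(γ)` with `∫ r² dγ ≤ E_γ|w|⁸/(2A)²` (`integral_rem_sq_le`),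
  which is what makes it negligible for `A` large.

Pattern and tools from `Theorems/BoltzmannGreenKubo/Negative/ForallN.lean` (`gB`, `reflB`,
`integral_stdGaussian_eq_zero_of_odd`); Gaussian moments by Fernique (`IsGaussian.memLp_id`).
-/

noncomputable section

namespace Summit.AtomisticToContinuum.HydrodynamicLimit.Theorems

open MeasureTheory ProbabilityTheory Filter Topology Set
open Literature.Analysis.FluidPDE Literature.MathematicalPhysics.KineticTheory
open scoped InnerProductSpace ENNReal
open BoltzmannGreenKuboForallN

namespace EquilibriumStressVarianceDecayC3

section Truncation

variable {A : ℝ} {t r : V3 → ℝ}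

/-- The truncation denominator is positive. [folklore] -/
theorem one_add_norm_sq_div_pos (hA : 0 < A) (w : V3) : 0 < 1 + ‖w‖ ^ 2 / A := by positivity

/-- `|w₀ w₁| ≤ |w|²/2`. [folklore] -/
theorem abs_coord_mul_coord_le (w : V3) : |w 0 * w 1| ≤ ‖w‖ ^ 2 / 2 := by
  rw [abs_mul, norm_sq_eq_three]
  nlinarith [sq_abs (w 0), sq_abs (w 1), sq_nonneg (|w 0| - |w 1|), sq_nonneg (w 2),
    abs_nonneg (w 0), abs_nonneg (w 1)]

/-- `t + r = w₀ w₁` (truncation plus remainder is the shear-stress germ). [folklore] -/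
theorem trunc_add_rem (hr : ∀ w, r w = w 0 * w 1 - t w) (w : V3) : t w + r w = w 0 * w 1 := by
  rw [hr]; ring

/-- `|t| ≤ |w₀ w₁|`. [folklore] -/
theorem abs_trunc_le_abs (hA : 0 < A) (ht : ∀ w, t w = w 0 * w 1 * (1 + ‖w‖ ^ 2 / A)⁻¹) (w : V3) :
    |t w| ≤ |w 0 * w 1| := by
  have hpos := one_add_norm_sq_div_pos hA w
  rw [ht, abs_mul, abs_inv, abs_of_pos hpos]
  calc |w 0 * w 1| * (1 + ‖w‖ ^ 2 / A)⁻¹ ≤ |w 0 * w 1| * 1 :=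
        mul_le_mul_of_nonneg_left (inv_le_one_of_one_le₀ (le_add_of_nonneg_right (by positivity))) (abs_nonneg _)
    _ = |w 0 * w 1| := mul_one _

/-- `|t| ≤ A/2` (the truncation is bounded). [folklore] -/
theorem abs_trunc_le (hA : 0 < A) (ht : ∀ w, t w = w 0 * w 1 * (1 + ‖w‖ ^ 2 / A)⁻¹) (w : V3) :
    |t w| ≤ A / 2 := by
  have hpos := one_add_norm_sq_div_pos hA w
  rw [ht, abs_mul, abs_inv, abs_of_pos hpos, ← div_eq_mul_inv, div_le_iff₀ hpos]
  have h1 := abs_coord_mul_coord_le w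
  have e : A / 2 * (1 + ‖w‖ ^ 2 / A) = A / 2 + ‖w‖ ^ 2 / 2 := by field_simp
  rw [e]
  linarith

/-- The truncation is continuous. [folklore] -/
theorem continuous_trunc (hA : 0 < A) (ht : ∀ w, t w = w 0 * w 1 * (1 + ‖w‖ ^ 2 / A)⁻¹) : Continuous t := by
  have h0 : Continuous fun w : V3 => w 0 := (EuclideanSpace.proj (𝕜 := ℝ) (0 : Fin 3)).continuous
  have h1 : Continuous fun w : V3 => w 1 := (EuclideanSpace.proj (𝕜 := ℝ) (1 : Fin 3)).continuous
  have h2 : Continuous fun w : V3 => (1 + ‖w‖ ^ 2 / A)⁻¹ :=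
    (continuous_const.add ((continuous_norm.pow 2).div_const A)).inv₀ fun w => (one_add_norm_sq_div_pos hA w).ne'
  rw [show t = fun w => w 0 * w 1 * (1 + ‖w‖ ^ 2 / A)⁻¹ from funext ht]
  exact (h0.mul h1).mul h2

/-- The remainder is continuous. [folklore] -/
theorem continuous_rem (hA : 0 < A) (ht : ∀ w, t w = w 0 * w 1 * (1 + ‖w‖ ^ 2 / A)⁻¹)
    (hr : ∀ w, r w = w 0 * w 1 - t w) : Continuous r := by
  have h0 : Continuous fun w : V3 => w 0 := (EuclideanSpace.proj (𝕜 := ℝ) (0 : Fin 3)).continuous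
  have h1 : Continuous fun w : V3 => w 1 := (EuclideanSpace.proj (𝕜 := ℝ) (1 : Fin 3)).continuous
  rw [show r = fun w => w 0 * w 1 - t w from funext hr]
  exact (h0.mul h1).sub (continuous_trunc hA ht)

/-- The truncation is odd under `w₀ ↦ −w₀`. [folklore] -/
theorem trunc_reflB_zero (ht : ∀ w, t w = w 0 * w 1 * (1 + ‖w‖ ^ 2 / A)⁻¹) (w : V3) :
    t (reflB 0 w) = -t w := by
  rw [ht, ht]
  simp only [reflB_apply, LinearIsometryEquiv.norm_map]
  simp

/-- The truncation is odd under `w₁ ↦ −w₁`. [folklore] -/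
theorem trunc_reflB_one (ht : ∀ w, t w = w 0 * w 1 * (1 + ‖w‖ ^ 2 / A)⁻¹) (w : V3) :
    t (reflB 1 w) = -t w := by
  rw [ht, ht]
  simp only [reflB_apply, LinearIsometryEquiv.norm_map]
  simp

/-- The remainder is odd under `w₀ ↦ −w₀`. [folklore] -/
theorem rem_reflB_zero (ht : ∀ w, t w = w 0 * w 1 * (1 + ‖w‖ ^ 2 / A)⁻¹)
    (hr : ∀ w, r w = w 0 * w 1 - t w) (w : V3) : r (reflB 0 w) = -r w := by
  rw [hr, hr, trunc_reflB_zero ht]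
  simp only [reflB_apply]
  simp
  ring

/-- Closed form of the remainder: `r w = w₀ w₁ |w|² / (A + |w|²)`. [folklore] -/
theorem rem_eq (hA : 0 < A) (ht : ∀ w, t w = w 0 * w 1 * (1 + ‖w‖ ^ 2 / A)⁻¹)
    (hr : ∀ w, r w = w 0 * w 1 - t w) (w : V3) : r w = w 0 * w 1 * (‖w‖ ^ 2 / (A + ‖w‖ ^ 2)) := by
  have hpos := one_add_norm_sq_div_pos hA w
  have hpos' : 0 < A + ‖w‖ ^ 2 := by positivity
  rw [hr, ht]
  field_simp
  ring

/-- `|r| ≤ |w|⁴/(2A)`: the remainder is small in `L²(γ)` for large `A`. [folklore] -/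
theorem abs_rem_le (hA : 0 < A) (ht : ∀ w, t w = w 0 * w 1 * (1 + ‖w‖ ^ 2 / A)⁻¹)
    (hr : ∀ w, r w = w 0 * w 1 - t w) (w : V3) : |r w| ≤ ‖w‖ ^ 4 / (2 * A) := by
  rw [rem_eq hA ht hr, abs_mul, abs_of_nonneg (by positivity : 0 ≤ ‖w‖ ^ 2 / (A + ‖w‖ ^ 2))]
  calc |w 0 * w 1| * (‖w‖ ^ 2 / (A + ‖w‖ ^ 2)) ≤ (‖w‖ ^ 2 / 2) * (‖w‖ ^ 2 / A) :=
        mul_le_mul (abs_coord_mul_coord_le w)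
          (div_le_div_of_nonneg_left (by positivity) hA (le_add_of_nonneg_right (by positivity)))
          (by positivity) (by positivity)
    _ = ‖w‖ ^ 4 / (2 * A) := by ring

/-- **The truncation is `γ`-orthogonal to `span(1, v, |v|²)`**, in the exact form of the hypothesis of
`FastObservableMeanErgodic` (oddness under the two coordinate reflections, which preserve `γ`).
[folklore] -/
theorem trunc_orth (hA : 0 < A) (ht : ∀ w, t w = w 0 * w 1 * (1 + ‖w‖ ^ 2 / A)⁻¹) (c₀ c₂ : ℝ) (b : V3) :
    ∫ v, t v * (c₀ + ⟪b, v⟫_ℝ + c₂ * ‖v‖ ^ 2) ∂stdGaussian V3 = 0 := by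
  set pa : V3 → ℝ := fun v => c₀ + (b 1 * v 1 + b 2 * v 2) + c₂ * ‖v‖ ^ 2 with hpa
  set pb : V3 → ℝ := fun v => b 0 * v 0 with hpb
  have hsplit : (fun v => t v * (c₀ + ⟪b, v⟫_ℝ + c₂ * ‖v‖ ^ 2)) = fun v => t v * pa v + t v * pb v := by
    funext v
    simp only [inner_eq_three, hpa, hpb]
    ring
  have hcoord : ∀ l : Fin 3, Integrable (fun v : V3 => v l) (stdGaussian V3) := fun l =>
    (memLp_coord_stdGaussian l 1 (by simp)).integrable le_rfl
  have hpa_i : Integrable pa (stdGaussian V3) :=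
    ((integrable_const c₀).add (((hcoord 1).const_mul _).add ((hcoord 2).const_mul _))).add
      (integrable_norm_sq_stdGaussian.const_mul c₂)
  have hpb_i : Integrable pb (stdGaussian V3) := (hcoord 0).const_mul _
  have hbd : ∀ p : V3 → ℝ, Integrable p (stdGaussian V3) → Integrable (fun v => t v * p v) (stdGaussian V3) := by
    intro p hp
    refine (hp.norm.const_mul (A / 2)).mono'
      ((continuous_trunc hA ht).measurable.aestronglyMeasurable.mul hp.aestronglyMeasurable)
      (Eventually.of_forall fun v => ?_)
    rw [Real.norm_eq_abs, abs_mul, Real.norm_eq_abs]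
    exact mul_le_mul_of_nonneg_right (abs_trunc_le hA ht v) (abs_nonneg _)
  rw [hsplit, integral_add (hbd pa hpa_i) (hbd pb hpb_i),
    integral_stdGaussian_eq_zero_of_odd (reflB 0) (G := fun v => t v * pa v),
    integral_stdGaussian_eq_zero_of_odd (reflB 1) (G := fun v => t v * pb v), add_zero]
  · intro w
    simp only [hpb, trunc_reflB_one ht, reflB_apply]
    simp
  · intro w
    simp only [hpa, trunc_reflB_zero ht, reflB_apply, LinearIsometryEquiv.norm_map]
    simp

/-- The truncation is `γ`-centred. [folklore] -/
theorem integral_trunc (ht : ∀ w, t w = w 0 * w 1 * (1 + ‖w‖ ^ 2 / A)⁻¹) : ∫ w, t w ∂stdGaussian V3 = 0 :=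
  integral_stdGaussian_eq_zero_of_odd (reflB 0) (trunc_reflB_zero ht)

/-- The remainder is `γ`-centred. [folklore] -/
theorem integral_rem (ht : ∀ w, t w = w 0 * w 1 * (1 + ‖w‖ ^ 2 / A)⁻¹) (hr : ∀ w, r w = w 0 * w 1 - t w) :
    ∫ w, r w ∂stdGaussian V3 = 0 :=
  integral_stdGaussian_eq_zero_of_odd (reflB 0) (rem_reflB_zero ht hr)

/-- The truncation is in `L²(γ)` (it is bounded). [folklore] -/
theorem memLp_trunc (hA : 0 < A) (ht : ∀ w, t w = w 0 * w 1 * (1 + ‖w‖ ^ 2 / A)⁻¹) :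
    MemLp t 2 (stdGaussian V3) :=
  MemLp.of_bound (continuous_trunc hA ht).measurable.aestronglyMeasurable (A / 2)
    (Eventually.of_forall fun w => by rw [Real.norm_eq_abs]; exact abs_trunc_le hA ht w)

/-- `|w|⁸` is `γ`-integrable (Fernique). [folklore] -/
theorem integrable_norm_pow_eight_stdGaussian :
    Integrable (fun w : V3 => ‖w‖ ^ 8) (stdGaussian V3) :=
  (IsGaussian.memLp_id _ 8 (by simp)).integrable_norm_pow (by norm_num)

/-- The remainder is in `L²(γ)` (dominated by `|w|⁴/(2A)`). [folklore] -/
theorem memLp_rem (hA : 0 < A) (ht : ∀ w, t w = w 0 * w 1 * (1 + ‖w‖ ^ 2 / A)⁻¹)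
    (hr : ∀ w, r w = w 0 * w 1 - t w) : MemLp r 2 (stdGaussian V3) := by
  have hm : AEStronglyMeasurable (fun w : V3 => ‖w‖ ^ 4 / (2 * A)) (stdGaussian V3) :=
    ((continuous_norm.pow 4).div_const _).measurable.aestronglyMeasurable
  have h8 : MemLp (fun w : V3 => ‖w‖ ^ 4 / (2 * A)) 2 (stdGaussian V3) := by
    rw [memLp_two_iff_integrable_sq hm]
    have e : (fun w : V3 => (‖w‖ ^ 4 / (2 * A)) ^ 2) = fun w => (1 / (2 * A)) ^ 2 * ‖w‖ ^ 8 := by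
      funext w; ring
    rw [e]
    exact integrable_norm_pow_eight_stdGaussian.const_mul _
  refine h8.of_le (continuous_rem hA ht hr).measurable.aestronglyMeasurable (Eventually.of_forall fun w => ?_)
  rw [Real.norm_eq_abs, Real.norm_eq_abs, abs_of_nonneg (by positivity : 0 ≤ ‖w‖ ^ 4 / (2 * A))]
  exact abs_rem_le hA ht hr w

/-- `∫ r² dγ ≤ E γ|w|⁸ / (2A)²` (→ 0 as `A → ∞`). [folklore] -/
theorem integral_rem_sq_le (hA : 0 < A) (ht : ∀ w, t w = w 0 * w 1 * (1 + ‖w‖ ^ 2 / A)⁻¹)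
    (hr : ∀ w, r w = w 0 * w 1 - t w) :
    ∫ w, r w ^ 2 ∂stdGaussian V3 ≤ (∫ w : V3, ‖w‖ ^ 8 ∂stdGaussian V3) / (2 * A) ^ 2 := by
  have h1 : ∫ w, r w ^ 2 ∂stdGaussian V3 ≤ ∫ w : V3, ‖w‖ ^ 8 / (2 * A) ^ 2 ∂stdGaussian V3 := by
    refine integral_mono (memLp_rem hA ht hr).integrable_sq (integrable_norm_pow_eight_stdGaussian.div_const _)
      fun w => ?_
    have h := abs_rem_le hA ht hr w
    have h' : r w ^ 2 ≤ (‖w‖ ^ 4 / (2 * A)) ^ 2 := by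
      rw [← sq_abs]
      exact pow_le_pow_left₀ (abs_nonneg _) h 2
    calc r w ^ 2 ≤ (‖w‖ ^ 4 / (2 * A)) ^ 2 := h'
      _ = ‖w‖ ^ 8 / (2 * A) ^ 2 := by ring
  rwa [integral_div] at h1

/-- `∫ t² dγ ≤ E γ|w|⁴` (uniformly in `A`). [folklore] -/
theorem integral_trunc_sq_le (hA : 0 < A) (ht : ∀ w, t w = w 0 * w 1 * (1 + ‖w‖ ^ 2 / A)⁻¹) :
    ∫ w, t w ^ 2 ∂stdGaussian V3 ≤ ∫ w : V3, ‖w‖ ^ 4 ∂stdGaussian V3 := by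
  refine integral_mono (memLp_trunc hA ht).integrable_sq integrable_norm_pow_four_stdGaussian fun w => ?_
  have h := (abs_trunc_le_abs hA ht w).trans (abs_coord_mul_coord_le w)
  have h' : t w ^ 2 ≤ (‖w‖ ^ 2 / 2) ^ 2 := by
    rw [← sq_abs]
    exact pow_le_pow_left₀ (abs_nonneg _) h 2
  calc t w ^ 2 ≤ (‖w‖ ^ 2 / 2) ^ 2 := h'
    _ ≤ ‖w‖ ^ 4 := by nlinarith [sq_nonneg (‖w‖ ^ 2)]

/-- **Existence of a truncation pair at every level** (the explicit formulas). [folklore] -/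
theorem exists_trunc_rem (A : ℝ) :
    ∃ t r : V3 → ℝ, (∀ w, t w = w 0 * w 1 * (1 + ‖w‖ ^ 2 / A)⁻¹) ∧ (∀ w, r w = w 0 * w 1 - t w) :=
  ⟨fun w => w 0 * w 1 * (1 + ‖w‖ ^ 2 / A)⁻¹, fun w => w 0 * w 1 - w 0 * w 1 * (1 + ‖w‖ ^ 2 / A)⁻¹,
    fun _ => rfl, fun _ => rfl⟩

end Truncation

end EquilibriumStressVarianceDecayC3

end Summit.AtomisticToContinuum.HydrodynamicLimit.Theorems

end
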